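import Literature.NumberTheory.Sieve.QuadraticRootsPrimeModuliDFIProposition2
import Literature.NumberTheory.Sieve.QuadraticRootsPrimeModuliDFIProposition4
import Literature.NumberTheory.Sieve.QuadraticRootsPrimeModuliDFIUnsmoothing
import HarnessLib

/-!
# Discharges of named facts of `QuadraticRootsPrimeModuliDFI.lean`

`Literature/NumberTheory/Sieve/QuadraticRootsPrimeModuliDFIDischarges.lean` — proofs-only
sibling of `QuadraticRootsPrimeModuliDFI.lean` (no definitions, no named facts). Each theorem
below closes a named fact `X : Prop` of that file as `X_holds : X` by composing an ACCEPTED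
reduction theorem of the tree with the ACCEPTED unconditional `_holds` discharges of all of
its hypotheses; nothing is re-proved and no statement is changed. Recorded by the librarian
sweep g25 (2026-08-16, pass 5c: facts dischargeable in one line from the tree's own lemmas),
so that the facts census, `#h21_route_deps` and the cone guardrail see these facts as
theorems.

Discharged here:

* `dukeFriedlanderIwaniec1995_proposition1_holds` :=
  `dukeFriedlanderIwaniec1995_proposition1_of_proposition4`
  `dukeFriedlanderIwaniec1995_proposition4_holds`
  (`QuadraticRootsPrimeModuliDFIUnsmoothing.lean`).
* `dukeFriedlanderIwaniec1995_proposition2_holds` :=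
  `dukeFriedlanderIwaniec1995_proposition2_of_proposition4`
  `dukeFriedlanderIwaniec1995_proposition4_holds`
  (`QuadraticRootsPrimeModuliDFIProposition2.lean`).

## References

* [DukeFriedlanderIwaniec1995] — see `lean/references.bib` and the docstring of the fact in `QuadraticRootsPrimeModuliDFI.lean`.
-/

namespace Literature.NumberTheory.Sieve

/-- **Discharge of the named fact `dukeFriedlanderIwaniec1995_proposition1`**
(`QuadraticRootsPrimeModuliDFI.lean`): DFI Proposition 1 (linear forms). Let `f = aX² + 2bX +
c ∈ ℤ[X]` with `D = ac − b² > 0`, `h ≥ 1`. Suppose `d ≪ M` and `h ≪ dM`. … — obtained as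
`dukeFriedlanderIwaniec1995_proposition1_of_proposition4` applied to the tree's unconditional
discharge `dukeFriedlanderIwaniec1995_proposition4_holds` of its hypothesis (reduction in
`QuadraticRootsPrimeModuliDFIUnsmoothing.lean`).
[cite: DukeFriedlanderIwaniec1995, Proposition 1 p. 425, (9)] -/
theorem dukeFriedlanderIwaniec1995_proposition1_holds :
    dukeFriedlanderIwaniec1995_proposition1 :=
  dukeFriedlanderIwaniec1995_proposition1_of_proposition4
    dukeFriedlanderIwaniec1995_proposition4_holds

/-- **Discharge of the named fact `dukeFriedlanderIwaniec1995_proposition2`**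
(`QuadraticRootsPrimeModuliDFI.lean`): DFI Proposition 2 (bilinear forms). Let `f = aX² + 2bX
+ c ∈ ℤ[X]` with `D = ac − b² > 0`, `h ≥ 1`, and let `α_m`, `β_n` be complex numbers supported
in `M < m ≤ 2M`, `N < n ≤ 2N`, with `β_n` supported on primes. For `h ≪ MN`: … — obtained as
`dukeFriedlanderIwaniec1995_proposition2_of_proposition4` applied to the tree's unconditional
discharge `dukeFriedlanderIwaniec1995_proposition4_holds` of its hypothesis (reduction in
`QuadraticRootsPrimeModuliDFIProposition2.lean`).
[cite: DukeFriedlanderIwaniec1995, Proposition 2 p. 426, (10)] -/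
theorem dukeFriedlanderIwaniec1995_proposition2_holds :
    dukeFriedlanderIwaniec1995_proposition2 :=
  dukeFriedlanderIwaniec1995_proposition2_of_proposition4
    dukeFriedlanderIwaniec1995_proposition4_holds

end Literature.NumberTheory.Sieve
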